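import Mathlib
import Summits.NavierStokesRegularity.NavierStokesRegularity.Theorems.WakeRatchetTailRatchetRelayDecay
import HarnessLib

/-!
# `WakeRatchet.TailRatchet` (stmt-NavierStokesRegularity-21808): EXPLICIT a-priori constants for the
# backward pantograph solution — `|h(t)| ≤ (A/(e−2))·e^{−t}`, hence `|h| ≤ 16A/(e−2) + 5∫|f|`

Support file for the crux `TailRatchet` (route `WakeRatchet`; MODEL lattice ODEs of Tao 2016 §1.2, §4 —
nothing in this file is a statement about the Navier–Stokes equations, and no item is closed here).

Context (`…RelaySolvability`, `…RelaySolvabilityLimit`, `…RelayDecay`; census of stmt-21808, programme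
"R-lac"): the nonlinear (quasi-Newton / contraction) step of the lacunary-`Λ` construction needs the inverse
of the bordered linearisation with EXPLICIT operator bounds.  `…RelaySolvability.pantograph_inhom_exists`
gives the growth constant `C = ‖u⋆‖` of the Banach fixed point only existentially; here it is made explicit
from `dist(0, u⋆) ≤ dist(0, T0)/(1 − 2/e)` and `‖T0‖ ≤ A/e`, sorry-free:

* `pantograph_inhom_exists_explicit` — for `f` continuous with `|f| ≤ A` on `(−∞,0]`: a solution `h` of
  `h' = 2e^{t/2}h(t/2) + f`, `h(0) = 0`, with **`|h(t)| ≤ (A/(e−2))·e^{−t}`** on `t ≤ 0`;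
* `pantograph_inhom_exists_explicit_bounded` — if moreover `∫_{(−∞,0]}|f| = F < ∞`:
  **`|h(t)| ≤ 16A/(e−2) + 5F`** on `t ≤ 0`, `h(t) → −∫w₁f` at `−∞` (so `∫w₁f = 0 ⇒` decay, and then
  `…RelayDecay` gives the `e^{γt}` rate with these explicit constants).

HONEST FRAMING: elementary real analysis; MODEL lattice only; the construction item and the crux stay open;
lacunary fronts do NOT refute `TailRatchet` (which needs `Λ → 1`).
-/

noncomputable section

set_option linter.dupNamespace false

namespace Summit.NavierStokesRegularity.NavierStokesRegularity.Theorems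

namespace WakeRatchetRelaySolvabilityExplicit

open MeasureTheory Set Filter Topology Real intervalIntegral
open scoped BoundedContinuousFunction
open WakeRatchetRelaySolvability WakeRatchetRelaySolvabilityLimit

variable {f : ℝ → ℝ} {A : ℝ}

/-- `e − 2 > 0`. [folklore] -/
theorem exp_one_sub_two_pos : 0 < Real.exp 1 - 2 := by
  have := Real.exp_one_gt_d9; linarith

/-- **EXISTENCE with an explicit growth constant.**  For `f` continuous with `|f| ≤ A` on `(−∞,0]` there is
`h` continuous, `h(0) = 0`, `h' = 2e^{t/2}h(t/2) + f` on `t < 0`, with `|h(t)| ≤ (A/(e−2)) e^{−t}` on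
`t ≤ 0`.
[cite: Tao2016AveragedNS, §1.2 (dyadic model); cell vocabulary (programme R-lac, step R-lac-2, explicit constants)] -/
theorem pantograph_inhom_exists_explicit (hf : Continuous f) (hA : ∀ s : ℝ, s ≤ 0 → |f s| ≤ A) :
    ∃ h : ℝ → ℝ, Continuous h ∧ h 0 = 0 ∧
      (∀ t : ℝ, t < 0 → HasDerivAt h (2 * Real.exp (t / 2) * h (t / 2) + f t) t) ∧
      ∀ t : ℝ, t ≤ 0 → |h t| ≤ A / (Real.exp 1 - 2) * Real.exp (-t) := by
  have hA0 : 0 ≤ A := (abs_nonneg _).trans (hA 0 le_rfl)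
  -- the operator (verbatim as in `…RelaySolvability`)
  let T : (ℝ →ᵇ ℝ) → (ℝ →ᵇ ℝ) := fun u =>
    BoundedContinuousFunction.mkOfBound
      ⟨fun t : ℝ => Real.exp (min t 0) * ∫ s in (0 : ℝ)..min t 0, (2 * u (s / 2) + f s),
        op_continuous hf u⟩ (2 * (2 * ‖u‖ + A)) (fun x y => by
          rw [Real.dist_eq]
          have hx := op_abs_le hA u x
          have hy := op_abs_le hA u y
          calc |Real.exp (min x 0) * (∫ s in (0 : ℝ)..min x 0, (2 * u (s / 2) + f s)) -
                Real.exp (min y 0) * (∫ s in (0 : ℝ)..min y 0, (2 * u (s / 2) + f s))|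
              ≤ |Real.exp (min x 0) * ∫ s in (0 : ℝ)..min x 0, (2 * u (s / 2) + f s)| +
                |Real.exp (min y 0) * ∫ s in (0 : ℝ)..min y 0, (2 * u (s / 2) + f s)| := abs_sub _ _
            _ ≤ 2 * (2 * ‖u‖ + A) := by linarith)
  have hT_apply : ∀ (u : ℝ →ᵇ ℝ) (t : ℝ),
      T u t = Real.exp (min t 0) * ∫ s in (0 : ℝ)..min t 0, (2 * u (s / 2) + f s) := fun u t => rfl
  set K : NNReal := ⟨2 / Real.exp 1, by positivity⟩ with hK
  have hKval : (K : ℝ) = 2 / Real.exp 1 := rfl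
  have hcontr : ContractingWith K T := by
    refine ⟨?_, LipschitzWith.of_dist_le_mul fun u v => ?_⟩
    · change (K : ℝ) < 1
      rw [hKval]; exact two_div_exp_one_lt_one
    · rw [hKval]
      refine (BoundedContinuousFunction.dist_le (by positivity)).2 fun t => ?_
      rw [Real.dist_eq, hT_apply, hT_apply]
      exact op_sub_abs_le hf u v t
  -- explicit bound on `‖T 0‖` and on the fixed point
  have hT0 : ‖T 0‖ ≤ A * Real.exp (-1) := by
    refine (BoundedContinuousFunction.norm_le (by positivity)).2 fun t => ?_
    rw [hT_apply, Real.norm_eq_abs]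
    set t' := min t 0 with ht'
    have ht'0 : t' ≤ 0 := min_le_right _ _
    have hint : ‖∫ s in (0 : ℝ)..t', (2 * (0 : ℝ →ᵇ ℝ) (s / 2) + f s)‖ ≤ A * |t' - 0| := by
      refine intervalIntegral.norm_integral_le_of_norm_le_const fun s hs => ?_
      have hs0 : s ≤ 0 := by
        rcases hs with ⟨_, h2⟩
        have : max 0 t' = 0 := max_eq_left ht'0
        rw [this] at h2; exact h2
      rw [Real.norm_eq_abs, BoundedContinuousFunction.coe_zero, Pi.zero_apply, mul_zero, zero_add]
      exact hA s hs0
    rw [sub_zero] at hint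
    rw [abs_mul, abs_of_pos (Real.exp_pos _), ← Real.norm_eq_abs]
    have hexp := abs_mul_exp_le_exp_neg_one ht'0
    calc Real.exp t' * ‖∫ s in (0 : ℝ)..t', (2 * (0 : ℝ →ᵇ ℝ) (s / 2) + f s)‖
        ≤ Real.exp t' * (A * |t'|) := mul_le_mul_of_nonneg_left hint (Real.exp_pos _).le
      _ = A * (|t'| * Real.exp t') := by ring
      _ ≤ A * Real.exp (-1) := mul_le_mul_of_nonneg_left hexp hA0
  have hdist := ContractingWith.dist_fixedPoint_le (hf := hcontr) (0 : ℝ →ᵇ ℝ)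
  have hnorm : ‖ContractingWith.fixedPoint T hcontr‖ ≤ A / (Real.exp 1 - 2) := by
    have h1 : dist (0 : ℝ →ᵇ ℝ) (ContractingWith.fixedPoint T hcontr) =
        ‖ContractingWith.fixedPoint T hcontr‖ := by rw [dist_comm, dist_zero_right]
    have h2 : dist (0 : ℝ →ᵇ ℝ) (T 0) = ‖T 0‖ := by rw [dist_comm, dist_zero_right]
    rw [h1, h2, hKval] at hdist
    have hden : 0 < 1 - 2 / Real.exp 1 := by linarith [two_div_exp_one_lt_one]
    have he : Real.exp (-1) = 1 / Real.exp 1 := by rw [Real.exp_neg, one_div]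
    have hE : Real.exp 1 ≠ 0 := (Real.exp_pos 1).ne'
    have hE2 : Real.exp 1 - 2 ≠ 0 := exp_one_sub_two_pos.ne'
    calc ‖ContractingWith.fixedPoint T hcontr‖ ≤ ‖T 0‖ / (1 - 2 / Real.exp 1) := hdist
      _ ≤ A * Real.exp (-1) / (1 - 2 / Real.exp 1) := div_le_div_of_nonneg_right hT0 hden.le
      _ = A / (Real.exp 1 - 2) := by
          rw [he]
          field_simp
  set ustar := ContractingWith.fixedPoint T hcontr with hustar
  have hfix : T ustar = ustar := ContractingWith.fixedPoint_isFixedPt (hf := hcontr)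
  -- the solution (verbatim as in `…RelaySolvability`)
  have hfix_t : ∀ t : ℝ, t ≤ 0 →
      ustar t = Real.exp t * ∫ s in (0 : ℝ)..t, (2 * ustar (s / 2) + f s) := by
    intro t ht
    have h1 : T ustar t = ustar t := by rw [hfix]
    rw [hT_apply, min_eq_left ht] at h1
    exact h1.symm
  set G : ℝ → ℝ := fun s => 2 * ustar (s / 2) + f s with hG_def
  have hGcont : Continuous G :=
    (continuous_const.mul (ustar.continuous.comp (continuous_id.div_const 2))).add hf
  set h : ℝ → ℝ := fun t => ∫ s in (0 : ℝ)..t, G s with hh_def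
  have hhcont : Continuous h :=
    intervalIntegral.continuous_primitive (fun a b => hGcont.intervalIntegrable a b) 0
  have hh0 : h 0 = 0 := by simp [hh_def]
  have hu_eq : ∀ t : ℝ, t ≤ 0 → ustar t = Real.exp t * h t := fun t ht => hfix_t t ht
  have hderiv : ∀ t : ℝ, HasDerivAt h (G t) t := fun t => (hGcont.integral_hasStrictDerivAt 0 t).hasDerivAt
  refine ⟨h, hhcont, hh0, fun t ht => ?_, fun t ht => ?_⟩
  · have hG_t : G t = 2 * Real.exp (t / 2) * h (t / 2) + f t := by
      simp only [hG_def]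
      rw [hu_eq (t / 2) (by linarith)]
      ring
    rw [← hG_t]
    exact hderiv t
  · have h1 : h t = Real.exp (-t) * ustar t := by
      rw [hu_eq t ht, ← mul_assoc, ← Real.exp_add, neg_add_cancel, Real.exp_zero, one_mul]
    rw [h1, abs_mul, abs_of_pos (Real.exp_pos _), mul_comm]
    refine mul_le_mul_of_nonneg_right ?_ (Real.exp_pos _).le
    rw [← Real.norm_eq_abs]
    exact (ustar.norm_coe_le_norm t).trans hnorm

/-- **EXPLICIT BOUNDED SOLUTION.**  For `f` continuous with `|f| ≤ A` on `(−∞,0]` and integrable there: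
a solution `h` (continuous, `h(0) = 0`) of `h' = 2e^{t/2}h(t/2) + f` with
`|h(t)| ≤ 16A/(e−2) + 5∫_{(−∞,0]}|f|` on `t ≤ 0` and `h(t) → −∫w₁f` as `t → −∞`. [folklore] -/
theorem pantograph_inhom_exists_explicit_bounded (hf : Continuous f) (hA : ∀ s : ℝ, s ≤ 0 → |f s| ≤ A)
    (hfi : IntegrableOn f (Iic 0)) :
    ∃ h : ℝ → ℝ, Continuous h ∧ h 0 = 0 ∧
      (∀ t : ℝ, t < 0 → HasDerivAt h (2 * Real.exp (t / 2) * h (t / 2) + f t) t) ∧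
      (∀ t : ℝ, t ≤ 0 → |h t| ≤ 16 * (A / (Real.exp 1 - 2)) + 5 * ∫ s in Iic (0 : ℝ), |f s|) ∧
      Tendsto h atBot (𝓝 (-∫ t in Iic (0 : ℝ), (∑' m : ℕ,
        (∏ i ∈ Finset.range m, ((-4 : ℝ) / (2 ^ (i + 1) - 1))) * Real.exp ((2 ^ m - 1) * t)) * f t)) := by
  obtain ⟨h, hc, h0, hde, hC⟩ := pantograph_inhom_exists_explicit hf hA
  have hB : ∀ t : ℝ, t ≤ 0 → |h t| ≤ 16 * (A / (Real.exp 1 - 2)) + 5 * ∫ s in Iic (0 : ℝ), |f s| :=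
    fun t ht => pantograph_inhom_bounded hf hfi hc.continuousOn hde h0 hC ht
  exact ⟨h, hc, h0, hde, hB, pantograph_inhom_tendsto hf hfi hc.continuousOn hde h0 hB⟩

end WakeRatchetRelaySolvabilityExplicit

end Summit.NavierStokesRegularity.NavierStokesRegularity.Theorems

end
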